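import Summits.BirchSwinnertonDyer.BirchSwinnertonDyer.Theorems.PrintX11aMultThreeWinding
import Summits.BirchSwinnertonDyer.BirchSwinnertonDyer.Theorems.PrintX11aMuCosetDoor
import Summits.BirchSwinnertonDyer.BirchSwinnertonDyer.Theorems.PrintX8MazurTateThreeCollapse
import Summits.BirchSwinnertonDyer.BirchSwinnertonDyer.Theorems.PrintX11aNonSurjMuAnHardDefs
import HarnessLib

/-!
# Route `PrintX11a`, crux U3 `UpperNonSurjThree` (item stmt-BirchSwinnertonDyer-20613), lines «finemu3» / «hardlocus3»:
# the REGISTERED μ-road stub `stub_muAnHardThree` (= `Theorems.X11aNonSurjMuAnHardThree`) FROM MAZUR'S MANIN-CONSTANT FACT ALONE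

Cell `bsd-print-x11a`, width seat bsd-line-x11a-p2 g2 (`--supports stmt-BirchSwinnertonDyer-20613 --as helper`). Theorems
only; no definition, no new named fact, no `sorry`. BSD is not proved by any of this; PARTITION currency 0 by itself.

* `norm_ratPlusSymbol_zero_le_one_of_prime` — `p`-integrality of `[0]⁺_f = L(f,1)/Ω⁺_f` (odd `p`) from ONE good Hecke
  prime `ℓ` with `a_ℓ ≢ ℓ + 1 (mod p)`: `(a_ℓ − ℓ − 1)[0]⁺ ∈ ½ℤ` (Hecke relation at the cusp `0` + Manin).
* **`muAnZeroAt_three_of_mult_of_irr`** — GREENBERG'S ANALYTIC `μ = 0` AT MULTIPLICATIVE `3`: for EVERY `E = W/ℚ`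
  (globally minimal) with multiplicative reduction at `3` and `E[3]` irreducible, `X11a.MuAnZeroAt W 3` (for every newform
  `f` of `W` and its period ratio `ϖ`, THE Mazur–Tate–Teitelbaum function of the reduction sign's kind has a coefficient of
  `ϖ·L` of norm `1`), modulo ONE named fact: Mazur 1978 Cor. 4.1 (`mazur_not_dvd_maninConstant_of_odd`, `‖ϖ‖₃ = 1`).
  Route: the winding theorem (`…MultThreeWinding`) gives a unit `[u/3ᵏ]⁺_f`, `k ≥ 1`, `3 ∤ u`; its Teichmüller coset
  modulo `3ᵏ` is `{u, −u}` (`MuCoset.exists_classMap_eq`, `μ₂(ℤ₃) = {±1}`), `[−r]⁺ = [r]⁺`, so the coset sum is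
  `2ϖ[u/3ᵏ]⁺`, a unit; `MuCoset.exists_norm_coeff_eq_one_of_cosetSum_{nonsplit,split}` give the coefficient.
* **`x11aNonSurjMuAnHardThree_of_mazur : mazur_not_dvd_maninConstant_of_odd → Theorems.X11aNonSurjMuAnHardThree`** —
  the REGISTERED STUB `stub_muAnHardThree` of the skeleton of record `Cruxes/UpperNonSurjThree/Lines/finemu3.lean` (sha16
  6c7ab46d) discharged modulo Mazur's fact, which is CONJUNCT 9 of `stub_pubFactsAn` (= K2's item 19949
  `KatoTwinFactsFiveAn`): with it the μ-road composition `UpperNonSurjThree_of_muRoad` closes U3 modulo `stub_pubFactsAn`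
  ALONE (the class / non-surjectivity / hard-locus hypotheses of the stub are not used).  Also the birth-line stub
  `x11aNonSurjMuAnAtThree_of_mazur : … → Theorems.X11aNonSurjMuAnAtThree`.
beyond-print: yes (Greenberg LNM 1716 Conj. 1.11 at a multiplicative prime for residually irreducible `E`: not in
print).  References: [GreenbergLNM1716] Conj. 1.11; [MazurTateTeitelbaum1986Invent] §I.4, §I.8, §I.10, §I.12–I.13, §I.17;
[Mazur1978] Cor. 4.1; [Manin1972] Prop. 1.4; [Washington1997] §7.2.
-/

set_option linter.dupNamespace false
set_option autoImplicit false

namespace Summit.BirchSwinnertonDyer.BirchSwinnertonDyer.Theorems.MultThreeMuAn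

open scoped MatrixGroups ModularForm
open CongruenceSubgroup Matrix.SpecialLinearGroup WeierstrassCurve
  Literature.NumberTheory.EllipticCurves Literature.NumberTheory.EllipticCurves.ModularForms
  Literature.NumberTheory.EllipticCurves.Rank1Residual
  Summit.BirchSwinnertonDyer.Rank1Residual
  Summit.BirchSwinnertonDyer.BirchSwinnertonDyer.Theorems.MultThreeWinding

noncomputable section

/-! ### `p`-integrality of `[0]⁺_f = L(f,1)/Ω⁺_f` from ONE non-Eisenstein Hecke prime -/

section ZeroIntegral

variable {N : ℕ} [NeZero N] {f : CuspForm (Gamma0 N) 2} {p : ℕ} [Fact p.Prime]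

/-- **`p`-integrality of `[0]⁺_f`** for an odd prime `p` and a rational newform `f ∈ S₂(Γ₀(N))` having a good
Hecke prime `ℓ ∤ N` with `a_ℓ(f) ≢ ℓ + 1 (mod p)`: the Hecke relation at the cusp `0`,
`a_ℓ [0]⁺ = ∑_{j mod ℓ} [j/ℓ]⁺ + [0]⁺`, and `[j/ℓ]⁺ − [0]⁺ = re{∞, γ_j∞}/Ω⁺ ∈ ½ℤ` for `γ_j = (∗ j; ∗ ℓ) ∈ Γ₀(N)`
(Manin), give `(a_ℓ − ℓ − 1)·[0]⁺ ∈ ½ℤ`. [cite: MazurTateTeitelbaum1986Invent, §I.4 (4.2), §I.8]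
[cite: Manin1972, Prop. 1.4] -/
theorem norm_ratPlusSymbol_zero_le_one_of_prime (hf : IsNewform0 f) (hQ : coeffField f = ⊥) (hp2 : p ≠ 2)
    {ℓ : ℕ} [Fact ℓ.Prime] (hℓN : ¬ ℓ ∣ N) {aℓ : ℤ} (haℓ : cuspCoeff f ℓ = aℓ)
    (haℓ1 : ¬ (p : ℤ) ∣ aℓ - (ℓ + 1)) :
    ‖((ratPlusSymbol f 0 : ℚ) : ℚ_[p])‖ ≤ 1 := by
  have hp : p.Prime := Fact.out
  have hℓ : ℓ.Prime := Fact.out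
  have hrat : ∀ r : ℚ, (ratPlusSymbol f r : ℝ) = normalizedPlusSymbol f r :=
    fun r ↦ ratCast_ratPlusSymbol_holds hf hQ r
  have hreal : ∀ n, (cuspCoeff f n).im = 0 := cuspCoeff_im_eq_zero_of_coeffField_eq_bot hQ
  obtain ⟨hΩpos, hre⟩ := plusPeriod_pos_and_realPeriods_eq isZLattice_periodLattice_holds hf hQ
  have hΩ : plusPeriod f ≠ 0 := hΩpos.ne'
  -- each `[j/ℓ]⁺ − [0]⁺`, `j : Fin ℓ`, lies in `½ℤ`
  have hterm : ∀ j : Fin ℓ, ∃ mj : ℤ,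
      ratPlusSymbol f ((0 + ((j : ℕ) : ℚ)) / ℓ) = ratPlusSymbol f 0 + (mj : ℚ) / 2 := by
    intro j
    by_cases hj0 : (j : ℕ) = 0
    · exact ⟨0, by simp [hj0]⟩
    · -- `γ_j = (a', j; -tN, ℓ) ∈ Γ₀(N)` with `a'ℓ + t(jN) = 1`
      have hcopN : Nat.Coprime ℓ ((j : ℕ) * N) :=
        Nat.Coprime.mul_right
          ((Nat.Prime.coprime_iff_not_dvd hℓ).mpr (Nat.not_dvd_of_pos_of_lt (Nat.pos_of_ne_zero hj0) j.2))
          ((Nat.Prime.coprime_iff_not_dvd hℓ).mpr hℓN)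
      have hcop : IsCoprime (ℓ : ℤ) (((j : ℕ) : ℤ) * (N : ℤ)) := by
        rw [Int.isCoprime_iff_gcd_eq_one]
        exact_mod_cast hcopN
      obtain ⟨a', t, hat⟩ := hcop
      have hdet : Matrix.det !![a', ((j : ℕ) : ℤ); -(t * (N : ℤ)), (ℓ : ℤ)] = 1 := by
        rw [Matrix.det_fin_two_of]; linear_combination hat
      have hmem : (⟨_, hdet⟩ : SL(2, ℤ)) ∈ Gamma0 N := Gamma0_mem.mpr (by simp)
      set γ : Gamma0 N := ⟨⟨_, hdet⟩, hmem⟩ with hγ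
      have hd : ((γ : SL(2, ℤ)) 1 1 : ℤ) ≠ 0 := by
        show (ℓ : ℤ) ≠ 0
        exact_mod_cast hℓ.ne_zero
      have h1 := ratCast_periodValue_eq hrat hreal γ hd
      obtain ⟨mj, hmj⟩ := PrintX8VerticalStevens.exists_re_cuspSymbol_eq f hre γ
      refine ⟨mj, ?_⟩
      have h2 : ((ratPlusSymbol f ((((j : ℕ) : ℤ) : ℚ) / ((ℓ : ℤ) : ℚ)) - ratPlusSymbol f 0 : ℚ) : ℝ) =
          (((mj : ℚ) / 2 : ℚ) : ℝ) := by
        have : ((ratPlusSymbol f ((((γ : SL(2, ℤ)) 0 1 : ℤ) : ℚ) / (((γ : SL(2, ℤ)) 1 1 : ℤ) : ℚ)) -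
            ratPlusSymbol f 0 : ℚ) : ℝ) = (((mj : ℚ) / 2 : ℚ) : ℝ) := by
          rw [h1, hmj]; push_cast; field_simp
        exact this
      have h3 : ratPlusSymbol f ((((j : ℕ) : ℤ) : ℚ) / ((ℓ : ℤ) : ℚ)) - ratPlusSymbol f 0 = (mj : ℚ) / 2 := by
        exact_mod_cast h2
      rw [zero_add]
      push_cast at h3
      linarith
  choose mj hmj using hterm
  -- the Hecke relation at `r = 0`
  have hU := intCast_mul_ratPlusSymbol ℓ hf hℓ hℓN haℓ hrat 0
  simp only [mul_zero] at hU
  simp_rw [hmj] at hU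
  rw [Finset.sum_add_distrib, Finset.sum_const, Finset.card_univ, Fintype.card_fin, nsmul_eq_mul,
    ← Finset.sum_div] at hU
  -- `(aℓ − ℓ − 1)·[0]⁺ = K/2`
  set K : ℤ := ∑ j : Fin ℓ, mj j with hK
  have hK' : ((aℓ : ℚ) - (ℓ + 1)) * ratPlusSymbol f 0 = (K : ℚ) / 2 := by
    rw [hK]; push_cast; linarith
  have hunit : ‖(((aℓ - (ℓ + 1) : ℤ) : ℚ) : ℚ_[p])‖ = 1 := by
    have hle : ‖(((aℓ - (ℓ + 1) : ℤ)) : ℚ_[p])‖ ≤ 1 := Padic.norm_int_le_one _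
    have hnlt : ¬ ‖(((aℓ - (ℓ + 1) : ℤ)) : ℚ_[p])‖ < 1 := by
      rw [Padic.norm_intCast_lt_one_iff]; exact haℓ1
    push_cast at hle hnlt ⊢
    exact le_antisymm hle (not_lt.mp hnlt)
  have h2unit : ‖(2 : ℚ_[p])‖ = 1 := by
    have hle : ‖(((2 : ℤ)) : ℚ_[p])‖ ≤ 1 := Padic.norm_int_le_one _
    have hnlt : ¬ ‖(((2 : ℤ)) : ℚ_[p])‖ < 1 := by
      rw [Padic.norm_intCast_lt_one_iff]
      intro h
      have : (p : ℤ) ≤ 2 := Int.le_of_dvd (by norm_num) h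
      have h2 := hp.two_le
      omega
    push_cast at hle hnlt
    exact le_antisymm hle (not_lt.mp hnlt)
  have hKle : ‖((K : ℚ) : ℚ_[p])‖ ≤ 1 := by
    have := Padic.norm_int_le_one (p := p) K
    simpa using this
  have hne : ((aℓ : ℚ) - (ℓ + 1)) ≠ 0 := by
    intro h0
    apply haℓ1
    have : (aℓ : ℚ) = ((ℓ + 1 : ℤ) : ℚ) := by push_cast; linarith
    rw [show aℓ = ℓ + 1 from by exact_mod_cast this, sub_self]
    exact dvd_zero _
  have hval : ratPlusSymbol f 0 = (K : ℚ) / 2 / ((aℓ : ℚ) - (ℓ + 1)) := by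
    field_simp; linarith
  rw [hval]
  push_cast
  rw [norm_div, norm_div]
  have haq : ‖((aℓ : ℚ_[p]) - ((ℓ : ℚ_[p]) + 1))‖ = 1 := by
    have := hunit; push_cast at this; exact this
  rw [haq, h2unit, div_one, div_one]
  simpa using hKle

end ZeroIntegral

/-! ### From a unit plus symbol to `μ^an = 0` at multiplicative `3` -/

section MuAn

/-- `∑ᶠ_{ξ ∈ μ₂(ℤ₃)} G(ξ) = G(1) + G(−1)`. [folklore] -/
theorem finsum_rootsOfUnity_three (G : ℤ_[3] → ℚ_[3]) :
    ∑ᶠ ξ : rootsOfUnity (torsionOrder 3) ℤ_[3], G ((ξ : ℤ_[3]ˣ) : ℤ_[3]) = G 1 + G (-1) := by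
  classical
  haveI := neZero_torsionOrder 3
  haveI : Fintype (rootsOfUnity (torsionOrder 3) ℤ_[3]) := Fintype.ofFinite _
  rw [finsum_eq_sum_of_fintype]
  exact PrintX8MazurTateThreeCollapse.sum_rootsOfUnity_eq (p := 3) rfl G

/-- **Greenberg's analytic `μ = 0` at MULTIPLICATIVE `3`, irreducible case — THEOREM modulo Mazur's Manin-constant
fact.** For every elliptic curve `E = W/ℚ` (globally minimal) with multiplicative reduction at `3` and `E[3]`
irreducible: `X11a.MuAnZeroAt W 3` — for every newform `f` of `W` and its period ratio `ϖ`, THE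
Mazur–Tate–Teitelbaum function of the reduction sign's kind has a coefficient of `ϖ·L` of `3`-adic norm `1`.
Route: a unit plus symbol `[u/3ᵏ]⁺_f` (`k ≥ 1`, `3 ∤ u`) from the winding theorem
`exists_one_le_norm_ratPlusSymbol_div_three_pow` (Atkin–Lehner-extended orbit trick); the Teichmüller coset of
`u` modulo `3ᵏ` is `{u, −u}` and `[−r]⁺ = [r]⁺`, so the coset sum is `2ϖ[u/3ᵏ]⁺`, a unit (`‖ϖ‖₃ = 1` by Mazur
Cor. 4.1, `‖[u/3ᵏ]⁺‖ = 1` by the all-levels integrality bound with `[0]⁺` `3`-integral); the tree's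
`MuCoset.exists_norm_coeff_eq_one_of_cosetSum_{nonsplit,split}` turn a unit coset sum into a unit coefficient.
[cite: GreenbergLNM1716, §1 Conj. 1.11 (p. 58)] [cite: MazurTateTeitelbaum1986Invent, §I.10, §I.12–I.13]
[cite: Mazur1978, Cor. 4.1] [cite: Manin1972, Prop. 1.4] -/
theorem muAnZeroAt_three_of_mult_of_irr (hMz : mazur_not_dvd_maninConstant_of_odd)
    (W : WeierstrassCurve ℚ) [W.IsElliptic] [W.IsGloballyMinimal]
    (hmult : W.HasMultiplicativeReductionAtPrime 3) (hirr : W.HasIrreducibleModPGaloisRep 3) :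
    X11a.MuAnZeroAt W 3 := by
  intro N _ f hf ϖ hϖ
  have h32 : (3 : ℕ) ≠ 2 := by decide
  have hQ : coeffField f = ⊥ := hf.coeffField_eq_bot
  have hper : ∀ (r : ℚ) (n : ℤ), ratPlusSymbol f (r + n) = ratPlusSymbol f r :=
    fun r n ↦ ratPlusSymbol_add_intCast_holds (f := f) r n
  -- `‖ϖ‖ = 1` (Mazur) and `‖[0]⁺‖ ≤ 1` (a good Hecke prime from irreducibility)
  have hϖ1 : ‖((ϖ : ℚ) : ℚ_[3])‖ = 1 :=
    X11b.ClassClosure.norm_ratCast_periodRatio_eq_one_of_mazur W 3 hMz h32 hmult hirr hf hϖ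
  obtain ⟨ℓ, hℓinst, -, hgoodℓ, hℓ1⟩ :=
    exists_prime_not_dvd_frobeniusTrace_sub not_irreducible_of_frobeniusTrace_congr_holds W 3 hirr
  haveI := hℓinst
  have h0 : ‖((ratPlusSymbol f 0 : ℚ) : ℚ_[3])‖ ≤ 1 :=
    norm_ratPlusSymbol_zero_le_one_of_prime hf.1 hQ h32 (not_dvd_level_of_isNewformOf hf hgoodℓ)
      (cuspCoeff_eq_frobeniusTrace_of_isNewformOf_holds hf hgoodℓ) hℓ1
  have h0' : ‖((ϖ * ratPlusSymbol f 0 : ℚ) : ℚ_[3])‖ ≤ 1 := by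
    push_cast; rw [norm_mul, hϖ1, one_mul]; exact h0
  have hint := X11a.MuCoset.norm_periodRatio_mul_ratPlusSymbol_le_one W 3 h32 hf hmult hϖ1.le h0'
  -- a unit symbol `[u/3ᵏ]⁺`, `k ≥ 1`, `u ∈ ℕ`, `3 ∤ u`
  obtain ⟨k, u₀, hk1, hu₀, hge₀⟩ := exists_one_le_norm_ratPlusSymbol_div_three_pow W hmult hirr hf
  set u : ℕ := u₀.natAbs with hu
  have hu3 : ¬ 3 ∣ u := by
    rw [hu, ← Int.natCast_dvd_natCast, Int.natCast_natAbs, dvd_abs]; exact_mod_cast hu₀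
  have hge : 1 ≤ ‖((ratPlusSymbol f ((u : ℚ) / (3 : ℚ) ^ k) : ℚ) : ℚ_[3])‖ := by
    have hcast : ((u : ℚ)) = ((u₀.natAbs : ℤ) : ℚ) := by rw [hu]; simp
    rcases Int.natAbs_eq u₀ with h | h
    · rw [hcast, ← h]; exact hge₀
    · have hu' : ((u : ℚ)) = -(u₀ : ℚ) := by
        rw [hcast]
        have := congrArg (fun z : ℤ ↦ (z : ℚ)) h
        push_cast at this ⊢
        linarith
      rw [hu', neg_div, ratPlusSymbol_neg]; exact hge₀
  -- the level `k = n + e₀`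
  obtain ⟨n, rfl⟩ : ∃ n, k = n + cyclotomicExponent 3 := ⟨k - 1, by
    rw [show cyclotomicExponent 3 = 1 from if_neg h32]; omega⟩
  haveI : NeZero (3 ^ (n + cyclotomicExponent 3)) := ⟨pow_ne_zero _ (by norm_num)⟩
  -- `‖ϖ [u/3ᵏ]⁺‖ = 1`
  have hval_u : ratPlusSymbol f ((((u : ZMod (3 ^ (n + cyclotomicExponent 3))).val : ℚ)) /
      (3 : ℚ) ^ (n + cyclotomicExponent 3)) = ratPlusSymbol f ((u : ℚ) / (3 : ℚ) ^ (n + cyclotomicExponent 3)) :=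
    (PrintX8MazurTateThreeCollapse.ratPlusSymbol_natCast_div_pow_eq_val f 3 _ u).symm
  have hunit_u : ‖((ϖ * ratPlusSymbol f ((u : ℚ) / (3 : ℚ) ^ (n + cyclotomicExponent 3)) : ℚ) : ℚ_[3])‖ = 1 := by
    refine le_antisymm ?_ ?_
    · have := hint (n + cyclotomicExponent 3) (u : ZMod (3 ^ (n + cyclotomicExponent 3)))
      rwa [show ((3 : ℕ) : ℚ) = 3 by norm_num, hval_u] at this
    · push_cast; rw [norm_mul, hϖ1, one_mul]; exact_mod_cast hge
  -- the Teichmüller coset of `u`: `u = ξ₀ · 4^{s₀}`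
  have hucop : Nat.Coprime u (3 ^ (n + cyclotomicExponent 3)) :=
    Nat.Coprime.pow_right _ ((Nat.coprime_comm).mp ((Nat.Prime.coprime_iff_not_dvd Nat.prime_three).mpr hu3))
  set U : (ZMod (3 ^ (n + cyclotomicExponent 3)))ˣ := ZMod.unitOfCoprime u hucop with hU
  have hUval : (U : ZMod (3 ^ (n + cyclotomicExponent 3))) = (u : ZMod (3 ^ (n + cyclotomicExponent 3))) :=
    ZMod.coe_unitOfCoprime u hucop
  obtain ⟨ξ₀, s₀, hξs⟩ := X11a.MuCoset.exists_classMap_eq 3 n U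
  set c : ZMod (3 ^ (n + cyclotomicExponent 3)) :=
    (cyclotomicGenerator 3 : ZMod (3 ^ (n + cyclotomicExponent 3))) ^ s₀.val with hc
  -- the coset sum `= 2 ϖ [u/3ᵏ]⁺`
  have hsum : (∑ᶠ ξ : rootsOfUnity (torsionOrder 3) ℤ_[3],
      ((ϖ * ratPlusSymbol f
        (((PadicInt.toZModPow (n + cyclotomicExponent 3) ((ξ : ℤ_[3]ˣ) : ℤ_[3]) * c).val : ℚ) /
          (3 : ℚ) ^ (n + cyclotomicExponent 3)) : ℚ) : ℚ_[3])) =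
      2 * ((ϖ * ratPlusSymbol f ((u : ℚ) / (3 : ℚ) ^ (n + cyclotomicExponent 3)) : ℚ) : ℚ_[3]) := by
    rw [finsum_rootsOfUnity_three (fun z ↦ ((ϖ * ratPlusSymbol f
        (((PadicInt.toZModPow (n + cyclotomicExponent 3) z * c).val : ℚ) /
          (3 : ℚ) ^ (n + cyclotomicExponent 3)) : ℚ) : ℚ_[3]))]
    simp only [map_one, one_mul, map_neg, neg_mul]
    -- `c = ±u`
    have hneg : ∀ x : ZMod (3 ^ (n + cyclotomicExponent 3)),
        ratPlusSymbol f (((-x).val : ℚ) / (3 : ℚ) ^ (n + cyclotomicExponent 3)) =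
          ratPlusSymbol f ((x.val : ℚ) / (3 : ℚ) ^ (n + cyclotomicExponent 3)) := by
      intro x
      have := PrintX8MazurTateThreeCollapse.ratPlusSymbol_neg_val_div_pow f 3 (n + cyclotomicExponent 3) x
      simpa using this
    have hcu : ratPlusSymbol f ((c.val : ℚ) / (3 : ℚ) ^ (n + cyclotomicExponent 3)) =
        ratPlusSymbol f ((u : ℚ) / (3 : ℚ) ^ (n + cyclotomicExponent 3)) := by
      rw [← hval_u]
      rcases PrintX8MazurTateThreeCollapse.coe_rootsOfUnity_eq_one_or_eq_neg_one (p := 3) rfl ξ₀ with h1 | h1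
      · rw [h1, map_one, one_mul] at hξs
        rw [hξs, hUval]
      · rw [h1, map_neg, map_one, neg_mul, one_mul, neg_eq_iff_eq_neg] at hξs
        rw [hξs, hneg, hUval]
    rw [hneg, hcu]; push_cast; ring
  have hunit : ‖∑ᶠ ξ : rootsOfUnity (torsionOrder 3) ℤ_[3],
      ((ϖ * ratPlusSymbol f
        (((PadicInt.toZModPow (n + cyclotomicExponent 3) ((ξ : ℤ_[3]ˣ) : ℤ_[3]) *
            (cyclotomicGenerator 3 : ZMod (3 ^ (n + cyclotomicExponent 3))) ^ s₀.val).val : ℚ) /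
          (3 : ℚ) ^ (n + cyclotomicExponent 3)) : ℚ) : ℚ_[3])‖ = 1 := by
    rw [← hc, hsum, norm_mul, hunit_u, mul_one]
    have hle : ‖(((2 : ℤ)) : ℚ_[3])‖ ≤ 1 := Padic.norm_int_le_one _
    have hnlt : ¬ ‖(((2 : ℤ)) : ℚ_[3])‖ < 1 := by
      rw [Padic.norm_intCast_lt_one_iff]; decide
    push_cast at hle hnlt
    exact le_antisymm hle (not_lt.mp hnlt)
  have hint' : ∀ (m : ℕ) (a : ZMod (3 ^ m)),
      ‖((ϖ * ratPlusSymbol f ((a.val : ℚ) / (3 : ℚ) ^ m) : ℚ) : ℚ_[3])‖ ≤ 1 := by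
    intro m a; have := hint m a; rwa [show ((3 : ℕ) : ℚ) = 3 by norm_num] at this
  refine ⟨fun hns L hL ↦ ?_, fun hs L hL ↦ ?_⟩
  · obtain ⟨j, -, hj⟩ := X11a.MuCoset.exists_norm_coeff_eq_one_of_cosetSum_nonsplit W 3 hf hmult hns ϖ hint' s₀
      hunit hL
    exact ⟨j, hj⟩
  · obtain ⟨j, -, hj⟩ := X11a.MuCoset.exists_norm_coeff_eq_one_of_cosetSum_split W 3 hf hs ϖ hint' s₀ hunit hL
    exact ⟨j, hj⟩

end MuAn

/-! ### The registered stub of line «finemu3» / «hardlocus3» and the birth-line stub, from Mazur's fact -/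

section Stub

/-- **The registered μ-road stub `stub_muAnHardThree` of crux U3 (`PrintX11a.UpperNonSurjThree`, item
stmt-BirchSwinnertonDyer-20613), lines «hardlocus3»/«finemu3» — DISCHARGED modulo Mazur's Manin-constant fact
(conjunct 9 of K2's item 19949 `KatoTwinFactsFiveAn`)**: `Theorems.X11aNonSurjMuAnHardThree` holds.  In fact the
class, non-surjectivity and hard-locus hypotheses are not used: `μ^an = 0` at multiplicative `3` holds for EVERY
`E/ℚ` with `E[3]` irreducible (`muAnZeroAt_three_of_mult_of_irr`). [cite: GreenbergLNM1716, §1 Conj. 1.11 (p. 58)]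
[cite: Mazur1978, Cor. 4.1] [cite: MazurTateTeitelbaum1986Invent, §I.10, §I.12–I.13] -/
theorem x11aNonSurjMuAnHardThree_of_mazur (hMz : mazur_not_dvd_maninConstant_of_odd) :
    Theorems.X11aNonSurjMuAnHardThree := by
  intro W _ _ p _ hX _hns hp3 _hhard N _ f hf ϖ hϖ a L hs hn hL
  subst hp3
  have hμ := muAnZeroAt_three_of_mult_of_irr hMz W hX.2.2.1 hX.2.2.2.1 f hf ϖ hϖ
  by_cases hsplit : W.HasSplitMultiplicativeReductionAtPrime 3
  · rw [hs hsplit] at hL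
    exact hμ.2 hsplit L ((isMultPAdicLFunctionOf_one_iff L).mp hL)
  · rw [hn hsplit] at hL
    exact hμ.1 hsplit L hL

/-- **The birth-line stub `stub_muAnAtThree` (`Theorems.X11aNonSurjMuAnAtThree`, whole U3 domain) from Mazur's
fact** — same proof. [cite: GreenbergLNM1716, §1 Conj. 1.11 (p. 58)] [cite: Mazur1978, Cor. 4.1] -/
theorem x11aNonSurjMuAnAtThree_of_mazur (hMz : mazur_not_dvd_maninConstant_of_odd) :
    Theorems.X11aNonSurjMuAnAtThree := by
  intro W _ _ p _ hX _hns hp3 N _ f hf ϖ hϖ a L hs hn hL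
  subst hp3
  have hμ := muAnZeroAt_three_of_mult_of_irr hMz W hX.2.2.1 hX.2.2.2.1 f hf ϖ hϖ
  by_cases hsplit : W.HasSplitMultiplicativeReductionAtPrime 3
  · rw [hs hsplit] at hL
    exact hμ.2 hsplit L ((isMultPAdicLFunctionOf_one_iff L).mp hL)
  · rw [hn hsplit] at hL
    exact hμ.1 hsplit L hL

end Stub

end

end Summit.BirchSwinnertonDyer.BirchSwinnertonDyer.Theorems.MultThreeMuAn
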